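import Summits.Ventures.Crystal3D.Bulk.HullFaceSubtended
import HarnessLib

/-!
# The ear step for the subtended-angle invariants: long faces exist off the whole fan, the base
# case on the whole fan, and how the corner fan of the face of an ear splits (rattler prune
# (d1)(d2), `DESIGN-L12-THEORY` §P-L3 (d), T2 §14)

HONEST FRAMING. Part of the venture `Summits/Ventures/Crystal3D` (cell `pub-crystal3d`, phase 2;
seat p3), generic and configuration-free (`X` any finite set of unit vectors of `ℝ³` with `0`
interior to its hull); nothing here mentions GAP(1.26). Bricks for the induction of
`Bulk/HullFaceSubtendedInduction.lean` (winding `2π ≤ subtSum` and the inner-path rows `SidesFar`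
for a point in the corner fan of a face, `Bulk/HullFaceSubtended.lean`):

* `three_le_facePeriod` (corners `< π` ⇒ every walk has period `≥ 3`),
  **`eq_univ_of_forall_facePeriod_le_three`** / `exists_long_face_of_ne_univ` — a covering
  connected sub-map all of whose faces are triangles IS the whole fan (Euler `2N − #S + 2F = 4`
  with `#S = 3F` gives `#S = 6N − 12 = #hullDarts`), so a proper sub-map has a face of period
  `≥ 4` and (`exists_ear_of_cover`) an ear;
* `facePeriod_univ`, `exists_combination_of_inCornerFan_univ`, **`subtended_univ`** — on the
  whole fan every face is a fan triangle with one-triangle corners, and both invariants are the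
  triangle rows `triangle_rows_of_mem_cone`;
* **`inCornerFan_ear_cases`** — when the diagonal `g` of an ear `e` is inserted
  (`S' = S ∪ {g, α g}`), a point in the corner fan of the face of `e` in `S` is either a
  nonnegative combination of the three vertices of the ear triangle or in the corner fan of the
  shortened face of `α g` in `S'` (first-return bookkeeping `retTime_subset_of_mem/_of_not_mem`
  of `Bulk/RotSysCorners.lean` and the splice facts of `Bulk/RotSysEarSplice.lean`).
-/

noncomputable section

namespace Summit.Ventures.Crystal3D

namespace HullRotSys

open Literature.Geometry.DiscreteGeometry Finset Equiv Real InnerProductGeometry Function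
open scoped InnerProductSpace

variable {X : Finset (EuclideanSpace ℝ (Fin 3))} {hX1 : ∀ y ∈ X, ‖y‖ = 1}
  {h0 : (0 : EuclideanSpace ℝ (Fin 3)) ∈ interior (convexHull ℝ (X : Set _))}

/-! ## Faces have period `≥ 3`; if all have period `3` the sub-map is the whole fan -/

/-- Under corners `< π`, every face walk has period `≥ 3` (a walk of period `≤ 2` would turn on
the spot, contradicting the left-turn fact). -/
theorem three_le_facePeriod {S : Finset ↥(hullDarts X)} (hS : RotSys.IsClosed (inv X) S)
    (hlt : ∀ z ∈ S, RotSys.cornerAt (rot hX1 h0) (dartWeight X) S z < π) {d : ↥(hullDarts X)}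
    (hd : d ∈ S) : 3 ≤ facePeriod hX1 h0 S d := by
  by_contra hlt3
  have hpos := facePeriod_pos (hX1 := hX1) (h0 := h0) S d
  have hturn := orient3_walk_pos hS hlt hd 0
  -- `v₂ = v₀` (period `1` or `2`), so the turn determinant vanishes
  have hper : ∀ t, faceVertex hX1 h0 S d (t + facePeriod hX1 h0 S d) = faceVertex hX1 h0 S d t :=
    faceVertex_add_period S d
  rcases (show facePeriod hX1 h0 S d = 1 ∨ facePeriod hX1 h0 S d = 2 by omega) with h1 | h2
  · have e : faceVertex hX1 h0 S d (0 + 1) = faceVertex hX1 h0 S d 0 := by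
      have := hper 0; rwa [h1] at this
    rw [e, orient3_self_left] at hturn
    exact lt_irrefl _ hturn
  · have e : faceVertex hX1 h0 S d (0 + 2) = faceVertex hX1 h0 S d 0 := by
      have := hper 0; rwa [h2] at this
    rw [e, orient3_self_right] at hturn
    exact lt_irrefl _ hturn

/-- **If every face of a covering connected sub-map has period `≤ 3` (and corners `< π`), the
sub-map is the whole fan** (Euler: `2N − #S + 2F = 4` with `#S = 3F` forces `#S = 6N − 12`). -/
theorem eq_univ_of_forall_facePeriod_le_three {S : Finset ↥(hullDarts X)}
    (hS : RotSys.IsClosed (inv X) S) (hcov : ∀ y ∈ X, ∃ z ∈ S, z.1.1 = y)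
    (hk : RotSys.numK (rot hX1 h0) (inv X) S = 1)
    (hlt : ∀ z ∈ S, RotSys.cornerAt (rot hX1 h0) (dartWeight X) S z < π)
    (hle : ∀ d ∈ S, facePeriod hX1 h0 S d ≤ 3) : S = univ := by
  classical
  set fc := RotSys.face (rot hX1 h0) (inv X) S with hfc
  have heuler := euler_of_cover (hX1 := hX1) (h0 := h0) hS hcov hk
  -- `#S = 3 · #faces`
  have hfib : ∀ F ∈ S.image fc, (S.filter fun x => fc x = F).card = 3 := by
    intro F hF
    obtain ⟨x₀, hx₀, rfl⟩ := mem_image.1 hF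
    have hset : (S.filter fun x => fc x = fc x₀) = fc x₀ := by
      ext x
      rw [mem_filter]
      constructor
      · rintro ⟨hx, hxe⟩; rw [← hxe]; exact RotSys.mem_face_self hx
      · intro hx
        exact ⟨RotSys.face_subset _ _ S x₀ hx, RotSys.face_eq_of_mem_face hx⟩
    rw [hset, hfc, card_face_eq_facePeriod hS hx₀]
    exact le_antisymm (hle x₀ hx₀) (three_le_facePeriod hS hlt hx₀)
  have hcard : S.card = 3 * (S.image fc).card := by
    rw [card_eq_sum_card_image fc S, Finset.sum_congr rfl hfib, sum_const, smul_eq_mul, mul_comm]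
  have h12 := card_hullDarts_add_twelve hX1 h0
  have hSc : S.card = (univ : Finset ↥(hullDarts X)).card := by
    rw [card_univ_darts]
    have : (S.card : ℤ) = 3 * ((S.image fc).card : ℤ) := by exact_mod_cast hcard
    have h12' : ((hullDarts X).card : ℤ) + 12 = 6 * (X.card : ℤ) := by exact_mod_cast h12
    have : (S.card : ℤ) = (hullDarts X).card := by linarith
    exact_mod_cast this
  exact eq_univ_of_card S hSc

/-- A proper sub-map (covering, connected, corners `< π`) has a face of period `≥ 4`. -/
theorem exists_long_face_of_ne_univ {S : Finset ↥(hullDarts X)}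
    (hS : RotSys.IsClosed (inv X) S) (hcov : ∀ y ∈ X, ∃ z ∈ S, z.1.1 = y)
    (hk : RotSys.numK (rot hX1 h0) (inv X) S = 1)
    (hlt : ∀ z ∈ S, RotSys.cornerAt (rot hX1 h0) (dartWeight X) S z < π) (hne : S ≠ univ) :
    ∃ d ∈ S, 4 ≤ facePeriod hX1 h0 S d := by
  by_contra H
  push Not at H
  exact hne (eq_univ_of_forall_facePeriod_le_three hS hcov hk hlt fun d hd => by
    have := H d hd; omega)

/-! ## The whole fan: every face is a fan triangle with one-triangle corners -/

/-- On the whole fan every face walk has period `3`. -/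
theorem facePeriod_univ (d : ↥(hullDarts X)) : facePeriod hX1 h0 univ d = 3 := by
  unfold facePeriod
  refine RotSys.minimalPeriod_eq_of_first_return _ d (by norm_num) (phi_univ_pow_three d) ?_
  intro k hk0 hk heq
  -- `k = 1, 2`: the tail moves
  have hv := congrArg (fun x : ↥(hullDarts X) => x.1) heq
  simp only [phi_univ_pow_apply] at hv
  rcases (show k = 1 ∨ k = 2 by omega) with rfl | rfl
  · simp only [iterate_one] at hv
    exact absurd hv (hullFace_ne_self d.2)
  · simp only [iterate_succ, iterate_zero, comp_apply, id_eq] at hv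
    exact absurd hv (hullFace_hullFace_ne_self hX1 h0 d.2)

/-- On the whole fan, a point in the corner fan of the face of `d = (y, a)` is a nonnegative
combination of `y, a` and the third vertex `succV X a y` of the fan triangle on the right. -/
theorem exists_combination_of_inCornerFan_univ {d : ↥(hullDarts X)} {z : EuclideanSpace ℝ (Fin 3)}
    (h : InCornerFan hX1 h0 univ d z) :
    ∃ a b c : ℝ, 0 ≤ a ∧ 0 ≤ b ∧ 0 ≤ c ∧
      z = a • d.1.1 + b • d.1.2 + c • succV X d.1.2 d.1.1 := by
  obtain ⟨t, i, hi, hz⟩ := h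
  -- one-triangle corners: `i = 0`
  have hret : RotSys.retTime (rot hX1 h0) univ (inv X (faceDart hX1 h0 univ d t)) = 1 :=
    RotSys.retTime_eq_of_first_return _ (mem_univ _) Nat.one_pos (mem_univ _)
      (fun m hm0 hm1 => absurd hm1 (by omega))
  rw [hret] at hi
  have hi0 : i = 0 := by omega
  subst hi0
  rw [pow_zero, Perm.one_apply, ← faceDart_mod, facePeriod_univ] at hz
  -- the three darts of the triangle `y → a → b → y`, `b = succV X a y`
  obtain ⟨⟨y, a⟩, hd⟩ := d
  set b := succV X a y with hb
  have h3 := hullFace_hullFace_hullFace hX1 h0 hd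
  have hF1 : hullFace X (y, a) = (a, b) := rfl
  have hF2 : hullFace X (a, b) = (b, succV X b a) := rfl
  have hby : succV X b a = y := by
    have := h3; rw [hF1, hF2, hullFace_mk] at this; exact (Prod.mk.inj this).1
  have hyb : succV X y b = a := by
    have := h3; rw [hF1, hF2, hullFace_mk, hby] at this; exact (Prod.mk.inj this).2
  have hval : ∀ n, (faceDart hX1 h0 univ ⟨(y, a), hd⟩ n).1 = (hullFace X)^[n] (y, a) := fun n => by
    unfold faceDart; exact phi_univ_pow_apply n _
  obtain ⟨α, β, γ, hα, hβ, hγ, hz⟩ := hz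
  simp only [inv_apply_val, Prod.fst_swap, Prod.snd_swap] at hz
  rcases (show t % 3 = 0 ∨ t % 3 = 1 ∨ t % 3 = 2 by omega) with ht | ht | ht <;> rw [ht] at hz
  · rw [hval 0, iterate_zero, id_eq] at hz
    simp only at hz
    -- dart `(a, y)`: cone of `a, y, succV a y = b`
    exact ⟨β, α, γ, hβ, hα, hγ, by rw [hz]; abel⟩
  · rw [hval 1, iterate_one, hF1] at hz
    simp only at hz
    rw [hby] at hz
    -- dart `(b, a)`: cone of `b, a, y`
    exact ⟨γ, β, α, hγ, hβ, hα, by rw [hz]; simp only; abel⟩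
  · rw [hval 2, show (2 : ℕ) = 1 + 1 from rfl, iterate_succ, iterate_one, comp_apply, hF1, hF2, hby]
      at hz
    simp only at hz
    rw [hyb] at hz
    -- dart `(y, b)`: cone of `y, b, a`
    exact ⟨α, γ, β, hα, hγ, hβ, by rw [hz]; simp only; abel⟩

/-- **Base case.** On the whole fan, a unit `z ∉ X` in the corner fan of the face of `d` satisfies
both invariants. -/
theorem subtended_univ {d : ↥(hullDarts X)} {z : EuclideanSpace ℝ (Fin 3)} (hz1 : ‖z‖ = 1)
    (hzX : z ∉ X) (h : InCornerFan hX1 h0 univ d z) :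
    2 * π ≤ subtSum hX1 h0 univ d z ∧ SidesFar hX1 h0 univ d z := by
  obtain ⟨α, β, γ, hα, hβ, hγ, hz⟩ := exists_combination_of_inCornerFan_univ h
  obtain ⟨⟨y, a⟩, hd⟩ := d
  simp only at hz
  set b := succV X a y with hb
  -- the walk: `w 0 = y`, `w 1 = a`, `w 2 = b`, `w 3 = y`
  have hval : ∀ n, (faceDart hX1 h0 univ ⟨(y, a), hd⟩ n).1 = (hullFace X)^[n] (y, a) := fun n => by
    unfold faceDart; exact phi_univ_pow_apply n _
  have hw : ∀ n, faceVertex hX1 h0 univ ⟨(y, a), hd⟩ n = ((hullFace X)^[n] (y, a)).1 := fun n => by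
    unfold faceVertex; rw [hval]
  have hw0 : faceVertex hX1 h0 univ ⟨(y, a), hd⟩ 0 = y := by rw [hw, iterate_zero, id_eq]
  have hw1 : faceVertex hX1 h0 univ ⟨(y, a), hd⟩ 1 = a := by rw [hw, iterate_one, hullFace_mk]
  have hw2 : faceVertex hX1 h0 univ ⟨(y, a), hd⟩ 2 = b := by
    rw [hw, show (2 : ℕ) = 1 + 1 from rfl, iterate_succ, iterate_one, comp_apply, hullFace_mk,
      hullFace_mk]
  have hw3 : faceVertex hX1 h0 univ ⟨(y, a), hd⟩ 3 = y := by
    have := faceVertex_add_period (hX1 := hX1) (h0 := h0) univ ⟨(y, a), hd⟩ 0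
    rw [facePeriod_univ, zero_add] at this
    rw [this, hw0]
  -- the triangle is honest
  have hya : (y, a) ∈ hullDarts X := hd
  have hay : (a, y) ∈ hullDarts X := swap_mem_hullDarts hd
  have hpos := isPosThird_succV hX1 h0 hay
  rw [← hb] at hpos
  have hy1 : ‖y‖ = 1 := hX1 y (fst_mem_of_mem_hullDarts hX1 hya)
  have ha1 : ‖a‖ = 1 := hX1 a (snd_mem_of_mem_hullDarts hX1 hya)
  have hbX : b ∈ X := by
    have := subset_of_mem_fanTriSets hX1 hpos.1
    exact this (by simp)
  have hb1 : ‖b‖ = 1 := hX1 b hbX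
  have hor : orient3 y a b ≠ 0 := by
    have := hpos.2; rw [orient3_swap_left] at this
    intro h0'; rw [h0'] at this; simp at this
  have hzy : y ≠ z := fun e => hzX (e ▸ fst_mem_of_mem_hullDarts hX1 hya)
  have hza : a ≠ z := fun e => hzX (e ▸ snd_mem_of_mem_hullDarts hX1 hya)
  have hzb : b ≠ z := fun e => hzX (e ▸ hbX)
  obtain ⟨hwind, hI1, hI2, hI3⟩ :=
    triangle_rows_of_mem_cone hz1 hy1 ha1 hb1 hzy hza hzb hor hα hβ hγ hz
  refine ⟨?_, ?_⟩
  · unfold subtSum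
    rw [facePeriod_univ, Finset.sum_range_succ, Finset.sum_range_succ, Finset.sum_range_one,
      hw0, hw1, hw2, hw3]
    linarith
  · intro t ht
    unfold perim
    rw [facePeriod_univ] at ht ⊢
    rw [Finset.sum_range_succ, Finset.sum_range_succ, Finset.sum_range_one, hw0, hw1, hw2, hw3]
    rcases (show t = 0 ∨ t = 1 ∨ t = 2 by omega) with rfl | rfl | rfl
    · rw [hw0, hw1]
      rw [angle_comm b y, angle_comm b a] at hI1
      linarith [angle_comm a b, angle_comm b y]
    · rw [hw1, hw2]
      linarith [angle_comm y a, angle_comm y b, angle_comm b y]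
    · rw [hw2, show (2 : ℕ) + 1 = 3 from rfl, hw3]
      linarith [angle_comm a b, angle_comm a y, angle_comm y a, angle_comm b y]

/-! ## The ear step: where the corner fan of the face of the ear goes -/

/-- **The corner fan of the face of an ear splits.** Let `e ∈ S` be an ear (`φ_S e = σ_H (α e)`)
on a face of period `m ≥ 4`, `f₁ = φ_S e`, `g = σ_H (α f₁)` the closing diagonal (`g ∉ S`),
`S' = S ∪ {g, α g}`. A point in the corner fan of the face of `e` in `S` is either a nonnegative
combination of the three vertices `v₀, v₁, v₂` of the ear triangle, or in the corner fan of the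
(shortened) face of `α g` in `S'`. -/
theorem inCornerFan_ear_cases {S : Finset ↥(hullDarts X)} (hS : RotSys.IsClosed (inv X) S)
    {e : ↥(hullDarts X)} (he : e ∈ S)
    (hear : RotSys.phi (rot hX1 h0) (inv X) S e = rot hX1 h0 (inv X e))
    (hm4 : 4 ≤ facePeriod hX1 h0 S e)
    (hgS : rot hX1 h0 (inv X (RotSys.phi (rot hX1 h0) (inv X) S e)) ∉ S)
    {z : EuclideanSpace ℝ (Fin 3)} (h : InCornerFan hX1 h0 S e z) :
    (∃ a b c : ℝ, 0 ≤ a ∧ 0 ≤ b ∧ 0 ≤ c ∧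
        z = a • faceVertex hX1 h0 S e 0 + b • faceVertex hX1 h0 S e 1 + c • faceVertex hX1 h0 S e 2) ∨
      InCornerFan hX1 h0 (S ∪ {rot hX1 h0 (inv X (RotSys.phi (rot hX1 h0) (inv X) S e)),
          inv X (rot hX1 h0 (inv X (RotSys.phi (rot hX1 h0) (inv X) S e)))})
        (inv X (rot hX1 h0 (inv X (RotSys.phi (rot hX1 h0) (inv X) S e)))) z := by
  have hrs : RotSys.IsRotSys (rot hX1 h0) (inv X) := isRotSys
  set φ := RotSys.phi (rot hX1 h0) (inv X) S with hφ
  set m := facePeriod hX1 h0 S e with hmdef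
  have hme : minimalPeriod φ e = m := rfl
  set f1 := φ e with hf1
  set g := rot hX1 h0 (inv X f1) with hgdef
  have htri : rot hX1 h0 (inv X g) = e := by
    rw [hgdef, hear]; exact rot_inv_rot_inv_rot_inv e
  set S' := S ∪ {g, inv X g} with hS'def
  have hsub : S ⊆ S' := subset_union_left
  have hαgS : inv X g ∉ S := RotSys.alpha_g_not_mem hrs hS hgS
  set φ' := RotSys.phi (rot hX1 h0) (inv X) S' with hφ'
  -- vertices of the ear triangle
  set v := faceVertex hX1 h0 S e with hvdef
  have hd0 : faceDart hX1 h0 S e 0 = e := faceDart_zero S e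
  have hd1 : faceDart hX1 h0 S e 1 = f1 := by rw [faceDart_succ, faceDart_zero]
  have hv0 : e.1.1 = v 0 := by rw [hvdef]; unfold faceVertex; rw [faceDart_zero]
  have hv1 : e.1.2 = v 1 := by rw [← hd0]; exact faceDart_snd S e 0
  have hv1' : f1.1.1 = v 1 := by rw [hvdef]; unfold faceVertex; rw [hd1]
  have hv2 : f1.1.2 = v 2 := by rw [← hd1]; exact faceDart_snd S e 1
  -- `f1 = σ (α e) = (v1, succV v1 v0)`, `g = σ (α f1) = (v2, succV v2 v1)`, `σ (α g) = e`
  have hf1val : f1.1 = (e.1.2, succV X e.1.2 e.1.1) := by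
    rw [hear, rot_apply_val, inv_apply_val]; rfl
  have hsucc10 : succV X (v 1) (v 0) = v 2 := by
    rw [← hv0, ← hv1, ← hv2, hf1val]
  have hgval : g.1 = (f1.1.2, succV X f1.1.2 f1.1.1) := by
    rw [hgdef, rot_apply_val, inv_apply_val]; rfl
  have heval : e.1 = (g.1.2, succV X g.1.2 g.1.1) := by
    rw [← htri, rot_apply_val, inv_apply_val]; rfl
  have hg2 : g.1.2 = v 0 := by rw [← hv0, heval]
  have hg1 : g.1.1 = v 2 := by rw [hgval, hv2]
  have hsucc21 : succV X (v 2) (v 1) = v 0 := by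
    rw [← hg2, hgval, hv2, hv1']
  have hsucc02 : succV X (v 0) (v 2) = v 1 := by
    rw [← hv1, heval, hg2, hg1]
  -- reduce the witness index below the period
  obtain ⟨t₀, i, hi, hz⟩ := h
  rw [← faceDart_mod] at hi hz
  set t := t₀ % facePeriod hX1 h0 S e with htdef
  have htm : t < m := Nat.mod_lt _ (facePeriod_pos S e)
  -- the four positions of `t`
  by_cases ht0 : t = 0
  · -- corner at `v₁` after `e`: one triangle, the ear itself
    rw [ht0, hd0] at hi hz
    have hret : RotSys.retTime (rot hX1 h0) S (inv X e) = 1 :=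
      RotSys.retTime_eq_of_first_return _ (hS _ he) Nat.one_pos
        (by rw [pow_one, ← hear]; exact RotSys.phi_apply_mem hS he)
        (fun n hn0 hn1 => absurd hn1 (by omega))
    rw [hret] at hi
    have hi0 : i = 0 := by omega
    rw [hi0, pow_zero, Perm.one_apply] at hz
    obtain ⟨a, b, c, ha, hb, hc, hz⟩ := hz
    rw [inv_apply_val, Prod.fst_swap, Prod.snd_swap, hv0, hv1, hsucc10] at hz
    exact Or.inl ⟨b, a, c, hb, ha, hc, by rw [hz]; abel⟩
  by_cases ht1 : t = 1
  · -- corner at `v₂` after `f₁`: the ear triangle, then the corner of `F'` at `g`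
    rw [ht1, hd1] at hi hz
    have hx : inv X f1 ∈ S := hS _ (RotSys.phi_apply_mem hS he)
    have hind : RotSys.induce (rot hX1 h0) S' (inv X f1) = g :=
      RotSys.induce_eq_of_first_return _ (hsub hx) Nat.one_pos (by rw [pow_one])
        (mem_union_right _ (mem_insert_self _ _)) (fun n hn0 hn1 => absurd hn1 (by omega))
    have hφ'αg : φ' (inv X g) = (φ ^ 2) e := RotSys.phi_union_ear_alpha_g hrs hS he hgS
    have hind2 : RotSys.induce (rot hX1 h0) S' g ∈ S := by
      have : RotSys.induce (rot hX1 h0) S' g = φ' (inv X g) := by rw [hφ', RotSys.phi_apply, hrs.α_inv]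
      rw [this, hφ'αg]; exact RotSys.phi_pow_apply_mem hS he 2
    have hsplit := RotSys.retTime_subset_of_not_mem (rot hX1 h0) hsub hx
      (by rw [hind]; exact hgS) (by rw [hind]; exact hind2)
    have hret1 : RotSys.retTime (rot hX1 h0) S' (inv X f1) = 1 :=
      RotSys.retTime_eq_of_first_return _ (hsub hx) Nat.one_pos
        (by rw [pow_one]; exact mem_union_right _ (mem_insert_self _ _))
        (fun n hn0 hn1 => absurd hn1 (by omega))
    rw [hsplit, hret1, hind] at hi
    rcases Nat.eq_zero_or_pos i with hi0 | hipos
    · rw [hi0, pow_zero, Perm.one_apply] at hz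
      obtain ⟨a, b, c, ha, hb, hc, hz⟩ := hz
      rw [inv_apply_val, Prod.fst_swap, Prod.snd_swap, hv1', hv2, hsucc21] at hz
      exact Or.inl ⟨c, b, a, hc, hb, ha, by rw [hz]; abel⟩
    · refine Or.inr ⟨0, i - 1, ?_, ?_⟩
      · rw [faceDart_zero, hrs.α_inv]; omega
      · rw [faceDart_zero, hrs.α_inv, show g = (rot hX1 h0 ^ 1) (inv X f1) by rw [pow_one],
          ← Perm.mul_apply, ← pow_add, show i - 1 + 1 = i by omega]
        exact hz
  by_cases htl : t = m - 1
  · -- corner at `v₀` after the last dart: the corner of `F'` there, then the ear triangle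
    have hx : inv X (faceDart hX1 h0 S e t) ∈ S := hS _ (faceDart_mem hS he t)
    have hlast : φ' (faceDart hX1 h0 S e t) = inv X g := by
      rw [htl]; unfold faceDart
      exact RotSys.phi_union_ear_last hrs hS he htri hgS (by rw [hme]; omega)
    have hind : RotSys.induce (rot hX1 h0) S' (inv X (faceDart hX1 h0 S e t)) = inv X g := by
      rw [← RotSys.phi_apply]; exact hlast
    have hφ'g : φ' g = e := RotSys.phi_union_ear_g he htri
    have hind2 : RotSys.induce (rot hX1 h0) S' (inv X g) ∈ S := by
      have : RotSys.induce (rot hX1 h0) S' (inv X g) = φ' g := by rw [hφ', RotSys.phi_apply]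
      rw [this, hφ'g]; exact he
    have hsplit := RotSys.retTime_subset_of_not_mem (rot hX1 h0) hsub hx
      (by rw [hind]; exact hαgS) (by rw [hind]; exact hind2)
    have hret1 : RotSys.retTime (rot hX1 h0) S' (inv X g) = 1 :=
      RotSys.retTime_eq_of_first_return _ (mem_union_right _ (mem_insert_of_mem (mem_singleton_self _)))
        Nat.one_pos (by rw [pow_one, htri]; exact hsub he) (fun n hn0 hn1 => absurd hn1 (by omega))
    rw [hsplit, hind, hret1] at hi
    set r' := RotSys.retTime (rot hX1 h0) S' (inv X (faceDart hX1 h0 S e t)) with hr'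
    rcases Nat.lt_or_ge i r' with hlt | hge
    · refine Or.inr ⟨m - 2, i, ?_, ?_⟩
      · have : faceDart hX1 h0 S' (inv X g) (m - 2) = faceDart hX1 h0 S e t := by
          rw [htl]; unfold faceDart
          exact RotSys.pow_phi_union_ear_alpha_g hrs hS he htri hgS (by omega) (by rw [hme]; omega)
            |>.trans (by rw [show m - 2 + 1 = m - 1 by omega])
        rw [this]; exact hlt
      · have : faceDart hX1 h0 S' (inv X g) (m - 2) = faceDart hX1 h0 S e t := by
          rw [htl]; unfold faceDart
          exact RotSys.pow_phi_union_ear_alpha_g hrs hS he htri hgS (by omega) (by rw [hme]; omega)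
            |>.trans (by rw [show m - 2 + 1 = m - 1 by omega])
        rw [this]; exact hz
    · have hir : i = r' := by omega
      rw [hir, hr', ← RotSys.induce_apply_of_mem _ (hsub hx), hind] at hz
      obtain ⟨a, b, c, ha, hb, hc, hz⟩ := hz
      rw [inv_apply_val, Prod.fst_swap, Prod.snd_swap, hg2, hg1, hsucc02] at hz
      exact Or.inl ⟨a, c, b, ha, hc, hb, by rw [hz]; abel⟩
  · -- `2 ≤ t ≤ m − 2`: the corner is untouched and belongs to `F'`
    have ht2 : 2 ≤ t := by omega
    have htm2 : t + 2 ≤ m := by omega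
    have hx : inv X (faceDart hX1 h0 S e t) ∈ S := hS _ (faceDart_mem hS he t)
    have hdt : faceDart hX1 h0 S' (inv X g) (t - 1) = faceDart hX1 h0 S e t := by
      unfold faceDart
      exact (RotSys.pow_phi_union_ear_alpha_g hrs hS he htri hgS (by omega) (by rw [hme]; omega)).trans
        (by rw [show t - 1 + 1 = t by omega])
    have hdt1 : faceDart hX1 h0 S' (inv X g) t = faceDart hX1 h0 S e (t + 1) := by
      unfold faceDart
      exact RotSys.pow_phi_union_ear_alpha_g hrs hS he htri hgS (by omega) (by rw [hme]; omega)
    have hmem : RotSys.induce (rot hX1 h0) S' (inv X (faceDart hX1 h0 S e t)) ∈ S := by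
      rw [← RotSys.phi_apply, ← hdt, ← faceDart_succ, show t - 1 + 1 = t by omega, hdt1]
      exact faceDart_mem hS he (t + 1)
    have hret := RotSys.retTime_subset_of_mem (rot hX1 h0) hsub hx hmem
    refine Or.inr ⟨t - 1, i, ?_, ?_⟩
    · rw [hdt, ← hret]; exact hi
    · rw [hdt]; exact hz

end HullRotSys

end Summit.Ventures.Crystal3D
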